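/-
Copyright: statement-level skeleton of a published paper (lit-balaban cell, Phase-2 proof seat p13, gen 11). No proof
claims beyond what the kernel checks below.
-/
import Mathlib.Analysis.SpecialFunctions.Log.Deriv
import Literature.MathematicalPhysics.QuantumFieldTheory.BalabanImbrieJaffe1984to88.BIJ88Resummation5710

/-!
# `BalabanImbrieJaffe1984to88.BIJ88LeadGroupCompose294` — T. Bałaban, J. Imbrie, A. Jaffe, *Effective action and cluster
properties of the abelian Higgs model*, Commun. Math. Phys. **114** (1988) 257–315 [BalabanImbrieJaffe1988]: Sect. 5.7,
pp. 292–295 — THE BOOKKEEPING THAT CARRIES THE GROUPS OF (5.7.10) TO THE LEADING TERMS (5.7.12), TO THE RESUMMED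
`log Z_m` DISPLAY OF p. 294 AND, FOR `m = k`, TO THE PERTURBATIVE FUNCTIONAL `Q^{(k)}` (5.7.15): the `m`-th group sees only the
scales `≥ m`, is additive in `log Z`, ignores the constant of *"Π_{j=0}^{m−1} Z^{(j),L^{j−m}}(Λ̄₂^{(m)},u) = Z_m(Λ̄₂^{(m)},u)·const"*,
and the `j`/`m` double sum is reorganised scale by scale with *"the term m = j … special"*

statement-level skeleton of published theorems with citation tags; proofs where landed; nothing here is a claim about the Yang–Mills mass gap

PDF held: `paper:balaban1988-cmp114-bij-abelian-higgs-effective-action` (journal page = PDF page + 256); pp. 292–295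
[PDF 36–39] read as IMAGES this session (CCITT renders `HOME/lit-balaban-p13/pages/original-p036-x2.png` … `-p039-x2.png`).

CITATION HEADER (lean-in-tree rule).  Part of the lit-balaban TYPED SKELETON (HOME `run/shared/lean/pub/lit-balaban/`):
rows **C2.Eq5.7.13-5.7.15** (claim; owner's flip criterion *"NOT composed: the resummation (5.7.10)–(5.7.12) feeding the
low-order words into Q^{(k)} = (5.7.15) and the (5.7.12)-parts of W₂^{(k)}"*) and **C2.Eq5.7.10-5.7.12** of
`HOME/lit-balaban-r16/ROWS-C2-part2.md`; unit `lit-balaban-p13` (gen 11), owner r16, referee ref-5.  Built BY NAME on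
`BIJ88Resummation5710` (`mixedPartial`, `lowOrder`, `leadGroup`, `eq5710`, `leadGroup_max_eq_sum_iteratedDeriv`) and on r16's
`BIJ88Sect5StatementsPart4.pertP` (the (5.6.14)/(5.14.2) functional; p02's (5.7.15) `pertQ5715 = pertP (logZ …)` by name); nothing
restated.

## The print (pp. 292–295, verbatim)

(5.7.10) p. 292: *"Note that Z^{(j)}_{Λ₁₀^{(j)}}(…) depends only on e_l for l ≥ j. Thus we can write the last expression as
Σ_{m=j}^{k} Σ_{n=1}^{n̄} (1/n!) Σ_{{j_α}: min_α j_α = m} [Π_α ∂/∂e′_{j_α} log Z^{(j)}_{Λ₁₀^{(j)}}(u_{k+1} exp(ie_jζ Σ_{l=j}^{k} e′_lÃ̃_l))]_{e′=0}.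
(5.7.10)"*; p. 292: *"The term m = j is special; we bound that term directly without resummation. […] Next we take an m > j
and we try to replace each C^{(j)}_{Λ₁₀^{(j)}}(u_{k+1}) with C^{(j)}_{B_{m−j}(Λ₃^{(m)})}(u_{k+1})."*; (5.7.12) p. 293: *"The leading
terms are now Σ_{n=1}^{n̄} (1/n!) Σ_{{j_α}: min_α j_α = m} [Π_α ∂/∂e′_{j_α} log Z^{(j)}_{B_{m−j}(Λ₃^{(m)})}(Λ̄₂^{(m)}, u_{k+1} exp(…))]_{e′=0},
(5.7.12)"*; p. 294: *"Now the leading terms can be rescaled to the L^{j−m}-lattice, and we sum over j < m. All the changes we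
have made allow us now to compose the normalization factors as Π_{j=0}^{m−1} Z^{(j),L^{j−m}}(Λ̄₂^{(m)}, u) = Z_m(Λ̄₂^{(m)}, u)·const,
where the m-step Gaussian normalization factor Z_m arises as in Eq. (2.40) of [7]. We obtain the perturbative expansion
Σ_{n=1}^{n̄} Σ_{{j_α}: min_α j_α = m} [Π_α ∂/∂e′_{j_α} log Z_m(Λ̄₂^{(m)}, u_{k+1} exp(ie_mL^{−m} Σ_{l=m}^{k} e′_lÃ̃_l^{L^{−m}}))]_{e′=0}"*;
p. 295: *"The term m = k is treated slightly differently. […] The result is our standard perturbative expansion in the field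
θ_kH_{k,loc}A^{(k)}, which we denote Q^{(k)}(u_{k+1}, θ_kH_{k,loc}A^{(k)})"* with (5.7.15)
*"Q^{(k)} = Σ_{n=1}^{n̄} dⁿ/de′ⁿ log[∫dφ … ]_{e′=0}"* (typed `BIJ88PertQ5715.pertQ5715 = BIJ88Sect5StatementsPart4.pertP (logZ …)`).

## What is kernel-checked (model level of `BIJ88Resummation5710`: `Φ = log Z(…)` as a function of the scale parameters
`e′ = (e′_l)_{l ∈ L}`, an INPUT; zero `sorry`, theorems only, no new definitions, no `Prop` facts)

* §1 *"depends only on e_l for l ≥ j"*: `leadGroup_congr_set`, **`leadGroup_filter_ge`** — the `m`-th group of (5.7.10) only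
  sees the scales `≥ m`, so for `j ≤ m` it is the same over `S_j = {l ∈ S : j ≤ l}` and over `S`.
* §2 additivity: `mixedPartial_add`, `mixedPartial_sum`, **`leadGroup_sum`**, `leadGroup_sub` (for `C^{n̄}` inputs).
* §3 constants: `mixedPartial_add_const`, **`leadGroup_add_const`** (orders `n ≥ 1` only).
* §4 THE p. 294 COMPOSITION ⇒ (5.7.12) WITH `log Z_m`: **`leadGroup_log_prod`** (`log Π_j Z_j = Σ_j log Z_j` inside the
  group) and **`leadGroup_log_of_prod_eq_mul_const`** — if `Π_{j<m} Z^{(j)}(e′) = Z_m(e′)·const` (positive, `C^{n̄}`) then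
  `Σ_{j<m} [m-th group of log Z^{(j)}] = [m-th group of log Z_m]`, the resummed display of p. 294.
* §5 the `j`/`m` bookkeeping: **`sum_lowOrder_eq_sum_groups`** — `Σ_{j∈S} lowOrder Φ_j n̄ S_j = Σ_{m∈S} Σ_{j∈S, j≤m}
  leadGroup Φ_j n̄ S m` ((5.7.10) for every `j`, then collecting the scale `m`), and `sum_groups_split` (*"the term m = j is
  special"*: `Σ_{j≤m} = [j = m] + Σ_{j<m}`).
* §6 `m = k`: **`pertP_eq_neg_taylor`** (r16's functional on a `C^{n̄}` function = `−Σ_{n=1}^{n̄}(1/n!)F^{(n)}(0)`, derivatives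
  within `[0,1]` = two-sided ones) and **`leadGroup_max_eq_neg_pertP`** — for the top scale `k = max S` the `k`-th group is
  `−pertP` of the one-scale function `t ↦ Φ(t·e_k)`: the shape of `−Q^{(k)}` (5.7.15) / `−𝒫` (5.6.14).
* §7 **`eq5712_compose`** — the three facts chained for one `m ∈ S`: `Σ_{j∈S, j≤m} [m-th group of log Z^{(j)}_m]
  = [m-th group of log Z^{(m)}_m] + [m-th group of log Z_m]` under `Π_{j<m} Z^{(j)}_m = Z_m·const`.
HONEST SCOPE: finite algebra and calculus of the functional; the functions `log Z^{(j)}(…)`, their replacements (5.7.11) and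
the composition identity (= [7] (2.40), row B1.Eq2.39, `Balaban1983to89.B1Eq239Normalization.display240`) are INPUTS
(hypotheses), the remainders `W″…W^{(vi)}` are the other rows' material.  NOT summit progress; NOT continuum; NOT Clay.  Imports
Literature and Mathlib only; modifies nothing.
-/

namespace Literature.MathematicalPhysics.QuantumFieldTheory.BalabanImbrieJaffe1984to88.BIJ88LeadGroupCompose294

open Finset
open BIJ88Resummation5710 (mixedPartial lowOrder leadGroup IsMinScale eq5710 leadGroup_eq_zero_of_not_mem
  leadGroup_max_eq_sum_iteratedDeriv)
open scoped BigOperators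

variable {L : Type*} [Fintype L] [DecidableEq L] [LinearOrder L]

/-! ## §1 *"depends only on e_l for l ≥ j"*: the `m`-th group only sees the scales `≥ m` -/

section Scales

omit [Fintype L] in
/-- the tuples with minimal scale `m` drawn from `S` and from `S'` coincide when `S` and `S'` agree on the scales `≥ m`.
[cite: BalabanImbrieJaffe1988, (5.7.10) p.292] -/
theorem filter_isMinScale_eq {n : ℕ} {S S' : Finset L} {m : L} (h : ∀ l, m ≤ l → (l ∈ S ↔ l ∈ S')) :
    (Fintype.piFinset fun _ : Fin n => S).filter (fun J => IsMinScale J m) =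
      (Fintype.piFinset fun _ : Fin n => S').filter (fun J => IsMinScale J m) := by
  ext J
  simp only [Finset.mem_filter, Fintype.mem_piFinset]
  constructor
  · rintro ⟨hJ, hmin⟩
    exact ⟨fun α => (h _ (hmin.2 α)).mp (hJ α), hmin⟩
  · rintro ⟨hJ, hmin⟩
    exact ⟨fun α => (h _ (hmin.2 α)).mpr (hJ α), hmin⟩

/-- the `m`-th group of (5.7.10) is the same over two scale sets agreeing on the scales `≥ m`.
[cite: BalabanImbrieJaffe1988, (5.7.10) p.292] -/
theorem leadGroup_congr_set (Φ : (L → ℝ) → ℝ) (nbar : ℕ) {S S' : Finset L} {m : L}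
    (h : ∀ l, m ≤ l → (l ∈ S ↔ l ∈ S')) : leadGroup Φ nbar S m = leadGroup Φ nbar S' m := by
  unfold leadGroup
  exact Finset.sum_congr rfl fun n _ => by rw [filter_isMinScale_eq h]

/-- **"Z^{(j)}(…) depends only on e_l for l ≥ j"** — for `j ≤ m` the `m`-th group over `S_j = {l ∈ S : j ≤ l}` (the sum
`Σ_{l=j}^{k}` of (5.7.10)) is the `m`-th group over all of `S`. [cite: BalabanImbrieJaffe1988, (5.7.10) p.292] -/
theorem leadGroup_filter_ge (Φ : (L → ℝ) → ℝ) (nbar : ℕ) (S : Finset L) {j m : L} (hjm : j ≤ m) :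
    leadGroup Φ nbar (S.filter fun l => j ≤ l) m = leadGroup Φ nbar S m :=
  leadGroup_congr_set Φ nbar fun l hl => by simp [Finset.mem_filter, le_trans hjm hl]

end Scales

/-! ## §2 Additivity in `log Z` -/

section Additive

omit [LinearOrder L] in
/-- mixed partials are additive (for `C^n` functions). [cite: BalabanImbrieJaffe1988, (5.7.10) p.292] -/
theorem mixedPartial_add {Φ Ψ : (L → ℝ) → ℝ} {n : ℕ} (hΦ : ContDiff ℝ n Φ) (hΨ : ContDiff ℝ n Ψ) (J : Fin n → L) :
    mixedPartial (fun e => Φ e + Ψ e) n J = mixedPartial Φ n J + mixedPartial Ψ n J := by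
  unfold mixedPartial
  rw [show (fun e => Φ e + Ψ e) = Φ + Ψ from rfl, iteratedFDeriv_add_apply hΦ.contDiffAt hΨ.contDiffAt]
  rfl

omit [LinearOrder L] in
/-- mixed partials of a finite sum of `C^n` functions. [cite: BalabanImbrieJaffe1988, (5.7.10) p.292] -/
theorem mixedPartial_sum {κ : Type*} (s : Finset κ) (Φ : κ → (L → ℝ) → ℝ) {n : ℕ} (hΦ : ∀ i ∈ s, ContDiff ℝ n (Φ i))
    (J : Fin n → L) : mixedPartial (fun e => ∑ i ∈ s, Φ i e) n J = ∑ i ∈ s, mixedPartial (Φ i) n J := by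
  unfold mixedPartial
  rw [iteratedFDeriv_fun_sum_apply fun i hi => (hΦ i hi).contDiffAt]
  exact map_sum (ContinuousMultilinearMap.applyAddHom _) _ _

/-- **THE `m`-TH GROUP IS ADDITIVE IN `log Z`**: for `C^{n̄}` functions `Φ_i`,
`leadGroup (Σ_i Φ_i) n̄ S m = Σ_i leadGroup Φ_i n̄ S m` (so a group of `log Π_j Z^{(j)}` is the sum of the groups).
[cite: BalabanImbrieJaffe1988, (5.7.10) p.292, p.294] -/
theorem leadGroup_sum {κ : Type*} (s : Finset κ) (Φ : κ → (L → ℝ) → ℝ) {nbar : ℕ}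
    (hΦ : ∀ i ∈ s, ContDiff ℝ nbar (Φ i)) (S : Finset L) (m : L) :
    leadGroup (fun e => ∑ i ∈ s, Φ i e) nbar S m = ∑ i ∈ s, leadGroup (Φ i) nbar S m := by
  unfold leadGroup
  rw [Finset.sum_comm]
  refine Finset.sum_congr rfl fun n hn => ?_
  have hn' : n ≤ nbar := (Finset.mem_Icc.mp hn).2
  have hΦn : ∀ i ∈ s, ContDiff ℝ n (Φ i) := fun i hi => (hΦ i hi).of_le (by exact_mod_cast hn')
  rw [Finset.sum_congr rfl fun J _ => mixedPartial_sum s Φ hΦn J, Finset.sum_comm, Finset.mul_sum]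

/-- … and under differences (the replaced minus the original `log Z^{(j)}`: what goes to the remainders).
[cite: BalabanImbrieJaffe1988, (5.7.11)–(5.7.12) p.293] -/
theorem leadGroup_sub {Φ Ψ : (L → ℝ) → ℝ} {nbar : ℕ} (hΦ : ContDiff ℝ nbar Φ) (hΨ : ContDiff ℝ nbar Ψ)
    (S : Finset L) (m : L) :
    leadGroup (fun e => Φ e - Ψ e) nbar S m = leadGroup Φ nbar S m - leadGroup Ψ nbar S m := by
  have h := leadGroup_sum (Finset.univ : Finset (Fin 2)) (fun i => if i = 0 then Φ else fun e => -Ψ e)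
    (nbar := nbar) (fun i _ => by
      by_cases hi : i = 0
      · simp only [hi, if_true]; exact hΦ
      · simp only [hi, if_false]; exact hΨ.neg) S m
  simp only [Fin.sum_univ_two, Fin.one_eq_zero_iff, OfNat.ofNat_ne_one, if_true, if_false] at h
  have hneg : leadGroup (fun e => -Ψ e) nbar S m = -leadGroup Ψ nbar S m := by
    unfold leadGroup mixedPartial
    rw [← Finset.sum_neg_distrib]
    refine Finset.sum_congr rfl fun n _ => ?_
    rw [← mul_neg, ← Finset.sum_neg_distrib]
    refine congrArg _ (Finset.sum_congr rfl fun J _ => ?_)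
    rw [show (fun e => -Ψ e) = -Ψ from rfl, iteratedFDeriv_neg_apply]
    rfl
  have hfun : (fun e => Φ e - Ψ e) = fun e => Φ e + -Ψ e := funext fun e => sub_eq_add_neg _ _
  rw [hfun, h, hneg, sub_eq_add_neg]

end Additive

/-! ## §3 Constants are invisible (orders `n ≥ 1`) -/

section Constants

omit [LinearOrder L] in
/-- a mixed partial of positive order ignores an additive constant (no differentiability needed).
[cite: BalabanImbrieJaffe1988, p.294] -/
theorem mixedPartial_add_const (Φ : (L → ℝ) → ℝ) (c : ℝ) {n : ℕ} (hn : n ≠ 0) (J : Fin n → L) :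
    mixedPartial (fun e => Φ e + c) n J = mixedPartial Φ n J := by
  obtain ⟨n, rfl⟩ := Nat.exists_eq_succ_of_ne_zero hn
  unfold mixedPartial
  rw [iteratedFDeriv_succ_eq_comp_right, iteratedFDeriv_succ_eq_comp_right]
  simp only [Function.comp_apply, fderiv_add_const]

/-- **THE `·const` OF THE p. 294 COMPOSITION IS INVISIBLE**: `leadGroup (Φ + c) n̄ S m = leadGroup Φ n̄ S m` (all orders in a
group are `≥ 1`). [cite: BalabanImbrieJaffe1988, p.294] -/
theorem leadGroup_add_const (Φ : (L → ℝ) → ℝ) (c : ℝ) (nbar : ℕ) (S : Finset L) (m : L) :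
    leadGroup (fun e => Φ e + c) nbar S m = leadGroup Φ nbar S m := by
  unfold leadGroup
  refine Finset.sum_congr rfl fun n hn => ?_
  have hn' : n ≠ 0 := by have := (Finset.mem_Icc.mp hn).1; omega
  rw [Finset.sum_congr rfl fun J _ => mixedPartial_add_const Φ c hn' J]

end Constants

/-! ## §4 The p. 294 composition `Π_{j<m} Z^{(j)} = Z_m·const` ⇒ the leading terms are derivatives of `log Z_m` -/

section Compose

/-- a group of `log Π_i Z_i` is the sum of the groups of the `log Z_i` (positive `C^{n̄}` factors).
[cite: BalabanImbrieJaffe1988, p.294] -/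
theorem leadGroup_log_prod {κ : Type*} (s : Finset κ) (Z : κ → (L → ℝ) → ℝ) {nbar : ℕ}
    (hpos : ∀ i ∈ s, ∀ e, 0 < Z i e) (hZ : ∀ i ∈ s, ContDiff ℝ nbar (Z i)) (S : Finset L) (m : L) :
    leadGroup (fun e => Real.log (∏ i ∈ s, Z i e)) nbar S m = ∑ i ∈ s, leadGroup (fun e => Real.log (Z i e)) nbar S m := by
  have h : (fun e => Real.log (∏ i ∈ s, Z i e)) = fun e => ∑ i ∈ s, Real.log (Z i e) :=
    funext fun e => Real.log_prod fun i hi => (hpos i hi e).ne'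
  rw [h]
  exact leadGroup_sum s _ (fun i hi => (hZ i hi).log fun e => (hpos i hi e).ne') S m

/-- **THE RESUMMED LEADING TERMS (p. 294)** — *"All the changes we have made allow us now to compose the normalization factors as
Π_{j=0}^{m−1} Z^{(j),L^{j−m}}(Λ̄₂^{(m)},u) = Z_m(Λ̄₂^{(m)},u)·const […] We obtain the perturbative expansion Σ_{n=1}^{n̄} Σ_{{j_α}: min_α
j_α = m} [Π_α ∂/∂e′_{j_α} log Z_m(…)]_{e′=0}"*: if `Π_{j∈s} Z^{(j)}(e′) = Z_m(e′)·c` for all `e′` with `c > 0` and positive `C^{n̄}`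
factors, then `Σ_{j∈s} leadGroup (log Z^{(j)}) n̄ S m = leadGroup (log Z_m) n̄ S m` (the composition identity itself is
[7] (2.40), an input here). [cite: BalabanImbrieJaffe1988, p.294, (5.7.12) p.293] -/
theorem leadGroup_log_of_prod_eq_mul_const {κ : Type*} (s : Finset κ) (Z : κ → (L → ℝ) → ℝ) {Zm : (L → ℝ) → ℝ}
    {c : ℝ} {nbar : ℕ} (hc : 0 < c) (hZm : ∀ e, 0 < Zm e) (hpos : ∀ i ∈ s, ∀ e, 0 < Z i e)
    (hZ : ∀ i ∈ s, ContDiff ℝ nbar (Z i)) (hprod : ∀ e, ∏ i ∈ s, Z i e = Zm e * c) (S : Finset L) (m : L) :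
    ∑ i ∈ s, leadGroup (fun e => Real.log (Z i e)) nbar S m = leadGroup (fun e => Real.log (Zm e)) nbar S m := by
  rw [← leadGroup_log_prod s Z hpos hZ S m]
  have h : (fun e => Real.log (∏ i ∈ s, Z i e)) = fun e => Real.log (Zm e) + Real.log c :=
    funext fun e => by rw [hprod e, Real.log_mul (hZm e).ne' hc.ne']
  rw [h, leadGroup_add_const]

end Compose

/-! ## §5 The `j`/`m` bookkeeping of (5.7.10): collecting the scale `m` from every `log Z^{(j)}`, `j ≤ m` -/

section Bookkeeping

/-- **(5.7.10) FOR EVERY `j`, THEN COLLECTED BY THE SCALE `m`**: with `S_j = {l ∈ S : j ≤ l}` (*"depends only on e_l for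
l ≥ j"*), `Σ_{j∈S} lowOrder Φ_j n̄ S_j = Σ_{m∈S} Σ_{j∈S, j≤m} leadGroup Φ_j n̄ S m` — the low-order terms of all the factors
`log Z^{(j)}` regrouped so that the scale `m` receives the `m`-th group of every `log Z^{(j)}`, `j ≤ m` (p. 292: *"we take an
m > j …"*, p. 294: *"we sum over j < m"*). [cite: BalabanImbrieJaffe1988, (5.7.10) p.292, p.294] -/
theorem sum_lowOrder_eq_sum_groups (Φ : L → (L → ℝ) → ℝ) (nbar : ℕ) (S : Finset L) :
    ∑ j ∈ S, lowOrder (Φ j) nbar (S.filter fun l => j ≤ l) =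
      ∑ m ∈ S, ∑ j ∈ S.filter (fun j => j ≤ m), leadGroup (Φ j) nbar S m := by
  have h1 : ∀ j ∈ S, lowOrder (Φ j) nbar (S.filter fun l => j ≤ l) =
      ∑ m ∈ S, if j ≤ m then leadGroup (Φ j) nbar S m else 0 := by
    intro j _
    rw [eq5710, Finset.sum_filter]
    refine Finset.sum_congr rfl fun m _ => ?_
    split_ifs with hjm
    · exact leadGroup_filter_ge (Φ j) nbar S hjm
    · rfl
  rw [Finset.sum_congr rfl h1, Finset.sum_comm]
  exact Finset.sum_congr rfl fun m _ => (Finset.sum_filter _ _).symm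

omit [Fintype L] in
/-- *"The term m = j is special; we bound that term directly without resummation"*: the collected sum at the scale `m ∈ S`
splits into the `j = m` term and the terms `j < m` (which are resummed). [cite: BalabanImbrieJaffe1988, p.292, p.294] -/
theorem sum_groups_split (G : L → ℝ) {S : Finset L} {m : L} (hm : m ∈ S) :
    ∑ j ∈ S.filter (fun j => j ≤ m), G j = G m + ∑ j ∈ S.filter (fun j => j < m), G j := by
  have h : S.filter (fun j => j ≤ m) = insert m (S.filter fun j => j < m) := by
    ext j
    simp only [Finset.mem_filter, Finset.mem_insert]
    constructor
    · rintro ⟨hj, hjm⟩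
      rcases hjm.lt_or_eq with h | h
      · exact Or.inr ⟨hj, h⟩
      · exact Or.inl h
    · rintro (rfl | ⟨hj, hjm⟩)
      · exact ⟨hm, le_rfl⟩
      · exact ⟨hj, hjm.le⟩
  rw [h, Finset.sum_insert (by simp)]

end Bookkeeping

/-! ## §6 The top scale `m = k`: the `k`-th group is `−𝒫` of the one-scale function ((5.6.14)/(5.7.15) shape) -/

section Top

/-- r16's functional of (5.6.14)/(5.14.2) (= p02's (5.7.15) `pertQ5715` by name) on a `C^{n̄}` function: the derivatives within
`[0,1]` at `0` are the two-sided ones, `pertP F n̄ = −Σ_{n<n̄} (1/(n+1)!)·F^{(n+1)}(0)`. [cite: BalabanImbrieJaffe1988, (5.7.15) p.295] -/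
theorem pertP_eq_neg_taylor {F : ℝ → ℝ} {nbar : ℕ} (hF : ContDiff ℝ nbar F) :
    BIJ88Sect5StatementsPart4.pertP F nbar =
      -∑ n ∈ Finset.range nbar, 1 / ((n + 1).factorial : ℝ) * iteratedDeriv (n + 1) F 0 := by
  rw [BIJ88Sect5StatementsPart4.pertP, ← Finset.sum_neg_distrib]
  refine Finset.sum_congr rfl fun n hn => ?_
  have hn' : n < nbar := Finset.mem_range.mp hn
  have hcd : ContDiffAt ℝ ((n + 1 : ℕ) : WithTop ℕ∞) F 0 :=
    (hF.of_le (by exact_mod_cast hn')).contDiffAt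
  rw [Set.uIcc_of_le zero_le_one, iteratedDerivWithin_eq_iteratedDeriv (uniqueDiffOn_Icc zero_lt_one) hcd
    (Set.left_mem_Icc.mpr zero_le_one)]
  ring

/-- the same with the print's indexation `−Σ_{n=1}^{n̄} (1/n!)·F^{(n)}(0)`. [cite: BalabanImbrieJaffe1988, (5.7.15) p.295] -/
theorem pertP_eq_neg_taylor_Icc {F : ℝ → ℝ} {nbar : ℕ} (hF : ContDiff ℝ nbar F) :
    BIJ88Sect5StatementsPart4.pertP F nbar =
      -∑ n ∈ Finset.Icc 1 nbar, 1 / (n.factorial : ℝ) * iteratedDeriv n F 0 := by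
  rw [pertP_eq_neg_taylor hF, ← Finset.Ico_add_one_right_eq_Icc, Finset.sum_Ico_eq_sum_range, Nat.add_sub_cancel]
  congr 1
  exact Finset.sum_congr rfl fun n _ => by rw [add_comm]

/-- **THE TOP GROUP IS `−𝒫` OF THE ONE-SCALE FUNCTION** — for the maximal scale `k` of `S` and `Φ ∈ C^{n̄}`:
`leadGroup Φ n̄ S k = −pertP (t ↦ Φ(t·e_k)) n̄`, i.e. the `m = k` group of (5.7.10) is (minus) r16's perturbative functional of
the function of the single parameter `e′_k` — the shape of `−Q^{(k)}` (5.7.15) (p. 295: *"The term m = k … The result is our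
standard perturbative expansion in the field θ_kH_{k,loc}A^{(k)}, which we denote Q^{(k)}"*).
[cite: BalabanImbrieJaffe1988, (5.7.10) p.292, (5.7.15) p.295] -/
theorem leadGroup_max_eq_neg_pertP {Φ : (L → ℝ) → ℝ} {nbar : ℕ} (hΦ : ContDiff ℝ nbar Φ) {S : Finset L} {k : L}
    (hk : k ∈ S) (hmax : ∀ l ∈ S, l ≤ k) :
    leadGroup Φ nbar S k =
      -BIJ88Sect5StatementsPart4.pertP (fun t : ℝ => Φ (t • (Pi.single k (1 : ℝ) : L → ℝ))) nbar := by
  have hline : ContDiff ℝ nbar (fun t : ℝ => Φ (t • (Pi.single k (1 : ℝ) : L → ℝ))) :=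
    hΦ.comp ((contDiff_id).smul contDiff_const)
  rw [leadGroup_max_eq_sum_iteratedDeriv hΦ hk hmax, pertP_eq_neg_taylor_Icc hline, neg_neg]

end Top

/-! ## §7 The chain for one scale `m` -/

section Chain

/-- **(5.7.10) → (5.7.12) → p. 294, COMPOSED FOR ONE SCALE `m ∈ S`** — with, inside the `m`-th group, the replaced functions
`Φ_j = log Z^{(j)}_m(e′)` (`Z^{(j)}_m` = `Z^{(j)}` after the replacements (5.7.11)/p. 294 made for this `m`; positive, `C^{n̄}`) and the
composition `Π_{j∈S, j<m} Z^{(j)}_m(e′) = Z_m(e′)·c` (`c > 0`; [7] (2.40)): the scale-`m` collection of the groups is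
`Σ_{j∈S, j≤m} leadGroup (log Z^{(j)}_m) n̄ S m = leadGroup (log Z^{(m)}_m) n̄ S m + leadGroup (log Z_m) n̄ S m` — the special
`j = m` term (→ `W^{(m)″}`, p. 292) plus THE LEADING TERMS AS DERIVATIVES OF `log Z_m` (p. 294 display; for `m = k` these are
`−Q^{(k)}`-shaped by `leadGroup_max_eq_neg_pertP`). [cite: BalabanImbrieJaffe1988, (5.7.12) p.293, p.294] -/
theorem eq5712_compose (Zj : L → (L → ℝ) → ℝ) {Zm : (L → ℝ) → ℝ} {c : ℝ} {nbar : ℕ} {S : Finset L} {m : L}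
    (hm : m ∈ S) (hc : 0 < c) (hZm : ∀ e, 0 < Zm e) (hpos : ∀ j ∈ S, ∀ e, 0 < Zj j e)
    (hZ : ∀ j ∈ S, ContDiff ℝ nbar (Zj j)) (hprod : ∀ e, ∏ j ∈ S.filter (fun j => j < m), Zj j e = Zm e * c) :
    ∑ j ∈ S.filter (fun j => j ≤ m), leadGroup (fun e => Real.log (Zj j e)) nbar S m =
      leadGroup (fun e => Real.log (Zj m e)) nbar S m + leadGroup (fun e => Real.log (Zm e)) nbar S m := by
  rw [sum_groups_split (fun j => leadGroup (fun e => Real.log (Zj j e)) nbar S m) hm,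
    leadGroup_log_of_prod_eq_mul_const (S.filter fun j => j < m) Zj hc hZm
      (fun j hj => hpos j (Finset.mem_filter.mp hj).1) (fun j hj => hZ j (Finset.mem_filter.mp hj).1) hprod S m]

end Chain

end Literature.MathematicalPhysics.QuantumFieldTheory.BalabanImbrieJaffe1984to88.BIJ88LeadGroupCompose294
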